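import Mathlib
import HarnessLib
import Summits.HubbardSuperconductivity.HubbardSuperconductivity.Theorems.KLProgrammeC4aFoldSignedLawSharpCore

/-!
# Route `KLProgramme` — crux C4a, S3 brick (B4) «(B4)-UMK1», (N5)/(M3) the SIGNED FOLD LAW, SHARP FORM: the `X₀·M^{−3/2}` terms carry only `log⁺(C·M/t)` (absorbed by
# the level integral), never `log⁺(G/t)` — the log-free post-side law the caustic pair layer needs

Cell `gate-hubbard-kl`, seat hubbard-kl-k3c3-p3 (g28; row «implicit-function / monotonicity route for μ(n)»).  Located brick for the (C)-closer lane hubbard-kl-c4a-1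
(stub (C) `stub_twoLeg_curvature` of `KLRegimeEngineV17F2`, stmt-HubbardSuperconductivity-20437), memo HOME/hubbard-kl-k3c3-p3/U1-CAUSTIC-SUP.md §4/§7 (M3).
In `…C4aFoldSignedLaw.abs_intervalIntegral_mul_deriv_comp_le_fold` the term `X₀L₂/σ²·σ⁻¹·(2 + 4log⁺(G/t))` is `M^{−3/2}·log⁺(G/t)`: after the level integral the
`|δ₀|^{−1/2}` then carries `log(1/|δ₀|)`, which is NOT integrable uniformly across a weakly transversal pair of caustic zeros (memo §3).  The log is a sup × L¹ artefact:
far from the fold point the slope grows (`|g′(v)| ≥ c₂|v − v*|`) and the band is high (`g ≥ m + 2M ≥ M` beyond `x₁ = 2√(M/c₂)`), so the IBP remainder decays like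
`1/|v − v*|²` there.  This file splits each outer branch at distance `x₁` from the fold point:
Tools: `…C4aFoldSignedLawSharpCore` (IBP with an integrable majorant of the remainder, the far-piece integrals, quadratic growth away from the fold point).
* **`abs_intervalIntegral_mul_deriv_comp_le_fold_sharp`** — THE SHARP SIGNED FOLD LAW: same setting as part 3 (fold point `v*`, `c₂ ≤ g″ ≤ L₂` in modulus, `|g| ≤ G`,
  kernel envelopes with floor `t`, weight `X ∈ C¹` vanishing at the window ends), with `M = max(t,|g(v*)|)`, `η = √M/(2√L₂)`, `σ = c₂η`, `x₁ = 2√(M/c₂)`, `σ₁ = c₂x₁`,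
  `G_M = M(1 + 4L₂/c₂)`, `W = β − α`:
  `|∫_{α..β} X·K′(g)| ≤ 8ηX₀/M² + 2·(4X₀/(Mσ) + (X₁/σ + X₀L₂/σ²)·σ⁻¹·(2 + 4log⁺(G_M/t))) + 2·(2X₀/(Mσ₁) + X₁/(c₂M)·log⁺(W/x₁) + X₀L₂/(c₂²M·x₁))`
  — every `X₀`-term is `∝ M^{−3/2}` with at most `log⁺(G_M/t) = log⁺((1+4L₂/c₂)M/t)`; the `X₁`-terms are `∝ M^{−1}` (the `B`-line).  The level layer without `log(1/|δ₀|)` on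
  `|δ₀|^{−1/2}` is the successor file.
Pure real analysis.  References: Salmhofer 1999 §4.5.3 [cite: Salmhofer1999]; FST II CPAM 51 (1998) §3 [cite: FeldmanSalmhoferTrubowitz1998].
-/

noncomputable section

namespace Summit.HubbardSuperconductivity.HubbardSuperconductivity.Theorems.C4a

set_option linter.dupNamespace false -- summit = problem name (single-conjunct summit), D-0017

open Real Set MeasureTheory intervalIntegral

variable {g X K : ℝ → ℝ}

/-! ## §4 The sharp signed fold law -/

set_option maxHeartbeats 1600000 in
/-- **THE SIGNED FOLD LAW, SHARP FORM** (see the module docstring).  Compared with part 3's `abs_intervalIntegral_mul_deriv_comp_le_fold`, `log⁺(G/t)` is replaced by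
`log⁺(G_M/t)`, `G_M = M(1 + 4L₂/c₂)`, at the price of the explicit far-piece terms `2·(2X₀/(Mσ₁) + X₁/(c₂M)·log⁺(W/x₁) + X₀L₂/(c₂²M·x₁))`, `x₁ = 2√(M/c₂)`, `σ₁ = c₂x₁`,
`W = β − α`; no global height bound is needed. -/
theorem abs_intervalIntegral_mul_deriv_comp_le_fold_sharp {α β vs c₂ L₂ t X₀ X₁ : ℝ} (hvs : vs ∈ Icc α β)
    (hg : ContDiff ℝ 2 g) (hcrit : deriv g vs = 0) (hc₂ : 0 < c₂) (hfloor : ∀ v ∈ Icc α β, c₂ ≤ iteratedDeriv 2 g v)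
    (hL₂ : ∀ v ∈ Icc α β, |iteratedDeriv 2 g v| ≤ L₂)
    (hK : ContDiff ℝ 1 K) (ht : 0 < t) (hK0 : ∀ u, |K u| ≤ (max t |u|)⁻¹) (hK1 : ∀ u, |deriv K u| ≤ (max t |u|)⁻¹ ^ 2)
    (hX : ContDiff ℝ 1 X) (hX₀ : ∀ v ∈ Icc α β, |X v| ≤ X₀) (hX₁ : ∀ v ∈ Icc α β, |deriv X v| ≤ X₁) (hXα : X α = 0) (hXβ : X β = 0) :
    |∫ v in α..β, X v * deriv K (g v)| ≤
      8 * (Real.sqrt (max t |g vs|) / (2 * Real.sqrt L₂)) * X₀ / (max t |g vs|) ^ 2 +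
        2 * (4 * X₀ / (max t |g vs| * (c₂ * (Real.sqrt (max t |g vs|) / (2 * Real.sqrt L₂)))) +
          (X₁ / (c₂ * (Real.sqrt (max t |g vs|) / (2 * Real.sqrt L₂))) +
              X₀ * L₂ / (c₂ * (Real.sqrt (max t |g vs|) / (2 * Real.sqrt L₂))) ^ 2) *
            ((c₂ * (Real.sqrt (max t |g vs|) / (2 * Real.sqrt L₂)))⁻¹ * (2 + 4 * log⁺ (max t |g vs| * (1 + 4 * L₂ / c₂) / t)))) +
        2 * (2 * X₀ / (max t |g vs| * (c₂ * (2 * Real.sqrt (max t |g vs| / c₂)))) +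
          X₁ / (c₂ * max t |g vs|) * log⁺ ((β - α) / (2 * Real.sqrt (max t |g vs| / c₂))) +
          X₀ * L₂ / (c₂ ^ 2 * max t |g vs| * (2 * Real.sqrt (max t |g vs| / c₂)))) := by
  -- constants
  obtain ⟨M, hM⟩ : ∃ M : ℝ, M = max t |g vs| := ⟨_, rfl⟩
  have hMpos : 0 < M := by rw [hM]; exact lt_max_of_lt_left ht
  have hL₂c : c₂ ≤ L₂ := (le_abs_self _).trans' (hfloor vs hvs) |>.trans (hL₂ vs hvs)
  have hL₂pos : 0 < L₂ := hc₂.trans_le hL₂c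
  obtain ⟨η, hη⟩ : ∃ η : ℝ, η = Real.sqrt M / (2 * Real.sqrt L₂) := ⟨_, rfl⟩
  have hsL : 0 < Real.sqrt L₂ := Real.sqrt_pos.2 hL₂pos
  have hsM : 0 < Real.sqrt M := Real.sqrt_pos.2 hMpos
  have hηpos : 0 < η := by rw [hη]; positivity
  have hη2 : L₂ * η ^ 2 = M / 4 := by
    rw [hη, div_pow, mul_pow, Real.sq_sqrt hMpos.le, Real.sq_sqrt hL₂pos.le]; field_simp; norm_num
  obtain ⟨σ, hσ⟩ : ∃ σ : ℝ, σ = c₂ * η := ⟨_, rfl⟩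
  have hσpos : 0 < σ := by rw [hσ]; positivity
  obtain ⟨x₁, hx₁⟩ : ∃ x₁ : ℝ, x₁ = 2 * Real.sqrt (M / c₂) := ⟨_, rfl⟩
  have hsMc : 0 < Real.sqrt (M / c₂) := Real.sqrt_pos.2 (by positivity)
  have hx₁pos : 0 < x₁ := by rw [hx₁]; positivity
  have hx₁2 : c₂ * x₁ ^ 2 = 4 * M := by
    rw [hx₁, mul_pow, Real.sq_sqrt (by positivity : 0 ≤ M / c₂)]; field_simp; norm_num
  obtain ⟨σ₁, hσ₁⟩ : ∃ σ₁ : ℝ, σ₁ = c₂ * x₁ := ⟨_, rfl⟩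
  have hσ₁pos : 0 < σ₁ := by rw [hσ₁]; positivity
  obtain ⟨GM, hGM⟩ : ∃ GM : ℝ, GM = M * (1 + 4 * L₂ / c₂) := ⟨_, rfl⟩
  have hGMpos : 0 < GM := by rw [hGM]; positivity
  have hX₀0 : 0 ≤ X₀ := (abs_nonneg _).trans (hX₀ vs hvs)
  have hX₁0 : 0 ≤ X₁ := (abs_nonneg _).trans (hX₁ vs hvs)
  have hαβ : α ≤ β := hvs.1.trans hvs.2
  -- `η ≤ x₁`
  have hηx₁ : η ≤ x₁ := by
    have h1 : η ^ 2 ≤ x₁ ^ 2 := by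
      have e1 : η ^ 2 = M / (4 * L₂) := by field_simp; linarith [hη2]
      have e2 : x₁ ^ 2 = 4 * M / c₂ := by field_simp; linarith [hx₁2]
      rw [e1, e2, div_le_div_iff₀ (by positivity) (by positivity)]
      nlinarith [hL₂c, hMpos, hc₂]
    nlinarith [h1, hηpos, hx₁pos]
  rw [← hM, ← hη, ← hσ, ← hx₁, ← hσ₁, ← hGM]
  -- the integrand is continuous
  have hFc : Continuous fun v => X v * deriv K (g v) := hX.continuous.mul ((hK.continuous_deriv le_rfl).comp hg.continuous)
  have hFi : ∀ p q : ℝ, IntervalIntegrable (fun v => X v * deriv K (g v)) volume p q := fun p q => hFc.intervalIntegrable p q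
  -- `|m| ≤ M`
  have hmM : |g vs| ≤ M := by rw [hM]; exact le_max_right _ _
  -- split points
  obtain ⟨a₁, ha₁⟩ : ∃ a₁ : ℝ, a₁ = max α (vs - η) := ⟨_, rfl⟩
  obtain ⟨b₁, hb₁⟩ : ∃ b₁ : ℝ, b₁ = min β (vs + η) := ⟨_, rfl⟩
  obtain ⟨a₀, ha₀⟩ : ∃ a₀ : ℝ, a₀ = max α (vs - x₁) := ⟨_, rfl⟩
  obtain ⟨b₀, hb₀⟩ : ∃ b₀ : ℝ, b₀ = min β (vs + x₁) := ⟨_, rfl⟩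
  have hαa₀ : α ≤ a₀ := by rw [ha₀]; exact le_max_left _ _
  have ha₀a₁ : a₀ ≤ a₁ := by rw [ha₀, ha₁]; exact max_le_max le_rfl (by linarith)
  have ha₁vs : a₁ ≤ vs := by rw [ha₁]; exact max_le hvs.1 (by linarith)
  have hvsb₁ : vs ≤ b₁ := by rw [hb₁]; exact le_min hvs.2 (by linarith)
  have hb₁b₀ : b₁ ≤ b₀ := by rw [hb₁, hb₀]; exact min_le_min le_rfl (by linarith)
  have hb₀β : b₀ ≤ β := by rw [hb₀]; exact min_le_left _ _
  have ha₁c : vs - η ≤ a₁ := by rw [ha₁]; exact le_max_right _ _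
  have hb₁c : b₁ ≤ vs + η := by rw [hb₁]; exact min_le_right _ _
  have ha₀c : vs - x₁ ≤ a₀ := by rw [ha₀]; exact le_max_right _ _
  have hb₀c : b₀ ≤ vs + x₁ := by rw [hb₀]; exact min_le_right _ _
  have hsplit : ∫ v in α..β, X v * deriv K (g v) =
      (∫ v in α..a₀, X v * deriv K (g v)) + (∫ v in a₀..a₁, X v * deriv K (g v)) + (∫ v in a₁..b₁, X v * deriv K (g v)) +
        (∫ v in b₁..b₀, X v * deriv K (g v)) + ∫ v in b₀..β, X v * deriv K (g v) := by
    rw [intervalIntegral.integral_add_adjacent_intervals (hFi _ _) (hFi _ _), intervalIntegral.integral_add_adjacent_intervals (hFi _ _) (hFi _ _),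
      intervalIntegral.integral_add_adjacent_intervals (hFi _ _) (hFi _ _), intervalIntegral.integral_add_adjacent_intervals (hFi _ _) (hFi _ _)]
  -- the core band: `|g v − m| ≤ M/4` for `|v − v*| ≤ η`
  have hcore : ∀ v ∈ Icc α β, |v - vs| ≤ η → (max t |g v|)⁻¹ ≤ 2 / M := fun v hv hvη => by
    have hband : |g v - g vs| ≤ L₂ * η ^ 2 := by
      refine (abs_sub_le_of_fold hg hvs hcrit hL₂ hv).trans ?_
      have : |v - vs| ^ 2 ≤ η ^ 2 := pow_le_pow_left₀ (abs_nonneg _) hvη 2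
      exact mul_le_mul_of_nonneg_left this hL₂pos.le
    exact inv_envelope_le_of_core ht hM hband (by rw [hη2])
  -- the far region: `g ≥ M` for `|v − v*| ≥ x₁`, hence the envelope is `≤ 1/M ≤ 2/M`
  have hfar : ∀ v ∈ Icc α β, x₁ ≤ |v - vs| → M ≤ g v ∧ (max t |g v|)⁻¹ ≤ 1 / M := fun v hv hvx => by
    have h1 := sub_ge_of_fold hg hvs hcrit hfloor hv
    have h2 : x₁ ^ 2 ≤ (v - vs) ^ 2 := by
      have := pow_le_pow_left₀ hx₁pos.le hvx 2
      rwa [sq_abs] at this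
    have h3 : 2 * M ≤ g v - g vs := by
      have := mul_le_mul_of_nonneg_left h2 (by positivity : 0 ≤ c₂ / 2)
      linarith [h1, hx₁2]
    have h4 : M ≤ g v := by have := neg_abs_le (g vs); linarith
    refine ⟨h4, ?_⟩
    rw [one_div]
    exact inv_anti₀ hMpos (h4.trans ((le_abs_self _).trans (le_max_right _ _)))
  -- (1) the core integral
  have hI₂ : |∫ v in a₁..b₁, X v * deriv K (g v)| ≤ 8 * η * X₀ / M ^ 2 := by
    have hpt : ∀ v ∈ Set.uIoc a₁ b₁, ‖X v * deriv K (g v)‖ ≤ X₀ * (2 / M) ^ 2 := fun v hv => by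
      rw [Set.uIoc_of_le (ha₁vs.trans hvsb₁)] at hv
      have hvI : v ∈ Icc α β := ⟨(hαa₀.trans ha₀a₁).trans hv.1.le, hv.2.trans (hb₁b₀.trans hb₀β)⟩
      have hvη : |v - vs| ≤ η := abs_le.2 ⟨by linarith [hv.1], by linarith [hv.2]⟩
      rw [Real.norm_eq_abs, abs_mul]
      have h1 := hcore v hvI hvη
      have h2 : |deriv K (g v)| ≤ (2 / M) ^ 2 :=
        (hK1 (g v)).trans (pow_le_pow_left₀ (inv_nonneg.2 (le_max_of_le_left ht.le)) h1 2)
      exact mul_le_mul (hX₀ v hvI) h2 (abs_nonneg _) hX₀0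
    have h := intervalIntegral.norm_integral_le_of_norm_le_const hpt
    rw [Real.norm_eq_abs, abs_of_nonneg (by linarith : 0 ≤ b₁ - a₁)] at h
    refine h.trans ?_
    have hlen : b₁ - a₁ ≤ 2 * η := by linarith
    calc X₀ * (2 / M) ^ 2 * (b₁ - a₁) ≤ X₀ * (2 / M) ^ 2 * (2 * η) := mul_le_mul_of_nonneg_left hlen (by positivity)
      _ = 8 * η * X₀ / M ^ 2 := by field_simp; ring
  -- (2) an inner-outer piece `[p,q]`: distance in `[η, x₁]` from `v*`; end values `|X||K(g)| ≤ X₀·(2/M)` at both ends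
  have hend_of : ∀ r ∈ Icc α β, (X r = 0 ∨ |r - vs| = η ∨ |r - vs| = x₁) → |X r| * |K (g r)| ≤ X₀ * (2 / M) := by
    intro r hr hr'
    rcases hr' with h0 | hη' | hx'
    · rw [h0, abs_zero, zero_mul]; positivity
    · have h1 := hcore r hr hη'.le
      exact mul_le_mul (hX₀ r hr) ((hK0 (g r)).trans h1) (abs_nonneg _) hX₀0
    · have h1 := (hfar r hr hx'.ge).2
      have h2 : (max t |g r|)⁻¹ ≤ 2 / M := h1.trans (div_le_div_of_nonneg_right (by norm_num) hMpos.le)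
      exact mul_le_mul (hX₀ r hr) ((hK0 (g r)).trans h2) (abs_nonneg _) hX₀0
  have hmid : ∀ p q : ℝ, α ≤ p → q ≤ β → p ≤ q → (∀ v ∈ Icc p q, η ≤ |v - vs| ∧ |v - vs| ≤ x₁) →
      (X p = 0 ∨ |p - vs| = η ∨ |p - vs| = x₁) → (X q = 0 ∨ |q - vs| = η ∨ |q - vs| = x₁) →
      |∫ v in p..q, X v * deriv K (g v)| ≤ 4 * X₀ / (M * σ) + (X₁ / σ + X₀ * L₂ / σ ^ 2) * (σ⁻¹ * (2 + 4 * log⁺ (GM / t))) := by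
    intro p q hαp hqβ hpq hband hp hq
    have hsub : ∀ v ∈ Icc p q, v ∈ Icc α β := fun v hv => ⟨hαp.trans hv.1, hv.2.trans hqβ⟩
    have hslope : ∀ v ∈ Icc p q, σ ≤ |deriv g v| := fun v hv => by
      rw [hσ]
      exact (mul_le_mul_of_nonneg_left (hband v hv).1 hc₂.le).trans (abs_deriv_ge_of_fold hg hvs hcrit hfloor (hsub v hv))
    have hest := abs_intervalIntegral_mul_deriv_comp_le_ends hpq hg hX hK hσpos hslope (fun v hv => hL₂ v (hsub v hv))
      (fun v hv => hX₀ v (hsub v hv)) fun v hv => hX₁ v (hsub v hv)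
    have hends : (|X p| * |K (g p)| + |X q| * |K (g q)|) / σ ≤ 4 * X₀ / (M * σ) := by
      have h1 := hend_of p (hsub p (left_mem_Icc.2 hpq)) hp
      have h2 := hend_of q (hsub q (right_mem_Icc.2 hpq)) hq
      rw [div_le_iff₀ hσpos]
      have e : 4 * X₀ / (M * σ) * σ = X₀ * (2 / M) + X₀ * (2 / M) := by
        field_simp
        ring
      rw [e]; exact add_le_add h1 h2
    -- the band stays below `GM` on the piece
    have hgGM : ∀ v ∈ Icc p q, |g v| ≤ GM := fun v hv => by
      have h1 := abs_sub_le_of_fold hg hvs hcrit hL₂ (hsub v hv)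
      have h2 : |v - vs| ^ 2 ≤ x₁ ^ 2 := pow_le_pow_left₀ (abs_nonneg _) (hband v hv).2 2
      have h3 : |g v| ≤ |g vs| + L₂ * x₁ ^ 2 := by
        have := abs_sub_abs_le_abs_sub (g v) (g vs)
        nlinarith [h1, h2, hL₂pos.le]
      have h4 : L₂ * x₁ ^ 2 = 4 * L₂ * M / c₂ := by
        have : x₁ ^ 2 = 4 * M / c₂ := by field_simp; linarith [hx₁2]
        rw [this]; ring
      rw [hGM]
      have h5 : M * (1 + 4 * L₂ / c₂) = M + 4 * L₂ * M / c₂ := by ring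
      rw [h5]; linarith [hmM]
    have hrem : ∫ v in p..q, |K (g v)| ≤ σ⁻¹ * (2 + 4 * log⁺ (GM / t)) := by
      have h1 : ∫ v in p..q, |K (g v)| ≤ ∫ v in p..q, (max t |g v|)⁻¹ :=
        intervalIntegral.integral_mono_on hpq ((hK.continuous.comp hg.continuous).abs.intervalIntegrable p q)
          ((continuous_inv_envelope (g := g) hg.continuous ht).intervalIntegrable p q) fun v _ => hK0 (g v)
      exact h1.trans (intervalIntegral_inv_envelope_comp_le_of_slope hpq (hg.of_le (by norm_num)) hσpos hslope ht hGMpos hgGM)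
    have hcoef : 0 ≤ X₁ / σ + X₀ * L₂ / σ ^ 2 := by positivity
    exact hest.trans (add_le_add hends (mul_le_mul_of_nonneg_left hrem hcoef))
  -- (3) a far piece: majorant bookkeeping
  have hposlogW : 0 ≤ log⁺ ((β - α) / x₁) := Real.posLog_nonneg
  have hfar_val : ∀ L : ℝ, x₁ ≤ L → L ≤ β - α →
      X₁ / (c₂ * M) * Real.log (L / x₁) + X₀ * L₂ / (c₂ ^ 2 * M) * (x₁⁻¹ - L⁻¹) ≤
        X₁ / (c₂ * M) * log⁺ ((β - α) / x₁) + X₀ * L₂ / (c₂ ^ 2 * M * x₁) := by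
    intro L hL hLW
    have hLpos : 0 < L := hx₁pos.trans_le hL
    have hlp : ∀ y : ℝ, Real.log y ≤ log⁺ y := fun y => by rw [Real.posLog_apply]; exact le_max_right _ _
    have h1 : Real.log (L / x₁) ≤ log⁺ ((β - α) / x₁) :=
      (Real.log_le_log (div_pos hLpos hx₁pos) (div_le_div_of_nonneg_right hLW hx₁pos.le)).trans (hlp _)
    have h2 : x₁⁻¹ - L⁻¹ ≤ x₁⁻¹ := by have := inv_pos.2 hLpos; linarith
    have h3 : X₀ * L₂ / (c₂ ^ 2 * M) * x₁⁻¹ = X₀ * L₂ / (c₂ ^ 2 * M * x₁) := by field_simp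
    have c1 : 0 ≤ X₁ / (c₂ * M) := by positivity
    have c2 : 0 ≤ X₀ * L₂ / (c₂ ^ 2 * M) := by positivity
    have h4 := mul_le_mul_of_nonneg_left h1 c1
    have h5 := mul_le_mul_of_nonneg_left h2 c2
    rw [← h3]
    linarith
  -- pointwise majorant on the far region, in terms of the distance `x = |v − v*| ≥ x₁`
  have hρpt : ∀ v ∈ Icc α β, x₁ ≤ |v - vs| →
      |(deriv X v * deriv g v - X v * iteratedDeriv 2 g v) / deriv g v ^ 2 * K (g v)| ≤
        (X₁ / (c₂ * |v - vs|) + X₀ * L₂ / (c₂ ^ 2 * |v - vs| ^ 2)) / M := fun v hv hvx => by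
    have hxpos : 0 < |v - vs| := hx₁pos.trans_le hvx
    have hg1 : c₂ * |v - vs| ≤ |deriv g v| := abs_deriv_ge_of_fold hg hvs hcrit hfloor hv
    have hgpos : 0 < |deriv g v| := lt_of_lt_of_le (by positivity) hg1
    have hKv : |K (g v)| ≤ 1 / M := (hK0 (g v)).trans (hfar v hv hvx).2
    rw [abs_mul, abs_div, abs_pow]
    have hnum : |deriv X v * deriv g v - X v * iteratedDeriv 2 g v| ≤ X₁ * |deriv g v| + X₀ * L₂ := by
      refine (abs_sub _ _).trans (add_le_add ?_ ?_)
      · rw [abs_mul]; exact mul_le_mul_of_nonneg_right (hX₁ v hv) (abs_nonneg _)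
      · rw [abs_mul]; exact mul_le_mul (hX₀ v hv) (hL₂ v hv) (abs_nonneg _) hX₀0
    have hfrac : |deriv X v * deriv g v - X v * iteratedDeriv 2 g v| / |deriv g v| ^ 2 ≤
        X₁ / (c₂ * |v - vs|) + X₀ * L₂ / (c₂ ^ 2 * |v - vs| ^ 2) := by
      have e1 : (X₁ * |deriv g v| + X₀ * L₂) / |deriv g v| ^ 2 = X₁ / |deriv g v| + X₀ * L₂ / |deriv g v| ^ 2 := by
        field_simp
      refine (div_le_div_of_nonneg_right hnum (by positivity)).trans ?_
      rw [e1]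
      refine add_le_add ?_ ?_
      · exact div_le_div_of_nonneg_left hX₁0 (by positivity) hg1
      · refine div_le_div_of_nonneg_left (by positivity) (by positivity) ?_
        have := pow_le_pow_left₀ (by positivity : 0 ≤ c₂ * |v - vs|) hg1 2
        rwa [mul_pow] at this
    have hfrac0 : 0 ≤ |deriv X v * deriv g v - X v * iteratedDeriv 2 g v| / |deriv g v| ^ 2 := by positivity
    calc |deriv X v * deriv g v - X v * iteratedDeriv 2 g v| / |deriv g v| ^ 2 * |K (g v)|
        ≤ (X₁ / (c₂ * |v - vs|) + X₀ * L₂ / (c₂ ^ 2 * |v - vs| ^ 2)) * (1 / M) := mul_le_mul hfrac hKv (abs_nonneg _) (hfrac0.trans hfrac)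
      _ = (X₁ / (c₂ * |v - vs|) + X₀ * L₂ / (c₂ ^ 2 * |v - vs| ^ 2)) / M := by rw [mul_one_div]
  -- the majorant as a function of the distance and its continuity/integrability away from `0`
  set F : ℝ → ℝ := fun x => (X₁ / (c₂ * x) + X₀ * L₂ / (c₂ ^ 2 * x ^ 2)) / M with hF
  have hFcont : ∀ a b : ℝ, 0 < a → a ≤ b → ContinuousOn F (uIcc a b) := fun a b ha hab => by
    rw [uIcc_of_le hab]
    have hne : ∀ x ∈ Icc a b, x ≠ 0 := fun x hx => (ha.trans_le hx.1).ne'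
    refine ContinuousOn.div_const (ContinuousOn.add ?_ ?_) M
    · exact continuousOn_const.div (continuousOn_const.mul continuousOn_id) fun x hx => mul_ne_zero hc₂.ne' (hne x hx)
    · exact continuousOn_const.div (continuousOn_const.mul (continuousOn_id.pow 2)) fun x hx => mul_ne_zero (by positivity) (pow_ne_zero 2 (hne x hx))
  have hFval : ∀ a b : ℝ, 0 < a → a ≤ b → ∫ x in a..b, F x =
      X₁ / (c₂ * M) * Real.log (b / a) + X₀ * L₂ / (c₂ ^ 2 * M) * (a⁻¹ - b⁻¹) := fun a b ha hab => by
    simp only [hF]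
    exact far_majorant_integral ha hab hc₂.ne' hMpos.ne'
  -- (3R) the right far piece
  have hI₅ : |∫ v in b₀..β, X v * deriv K (g v)| ≤
      2 * X₀ / (M * σ₁) + (X₁ / (c₂ * M) * log⁺ ((β - α) / x₁) + X₀ * L₂ / (c₂ ^ 2 * M * x₁)) := by
    have hRHS0 : 0 ≤ 2 * X₀ / (M * σ₁) + (X₁ / (c₂ * M) * log⁺ ((β - α) / x₁) + X₀ * L₂ / (c₂ ^ 2 * M * x₁)) := by
      have h1 : 0 ≤ 2 * X₀ / (M * σ₁) := by positivity
      have h2 : 0 ≤ X₁ / (c₂ * M) * log⁺ ((β - α) / x₁) := mul_nonneg (by positivity) hposlogW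
      have h3 : 0 ≤ X₀ * L₂ / (c₂ ^ 2 * M * x₁) := by positivity
      linarith
    rcases le_total (vs + x₁) β with h1 | h1
    · have hb : b₀ = vs + x₁ := by rw [hb₀, min_eq_right h1]
      have hsub : ∀ v ∈ Icc b₀ β, v ∈ Icc α β := fun v hv => ⟨by rw [hb] at hv; linarith [hv.1, hvs.1], hv.2⟩
      have hdist : ∀ v ∈ Icc b₀ β, x₁ ≤ |v - vs| ∧ |v - vs| = v - vs := fun v hv => by
        rw [hb] at hv
        have : 0 ≤ v - vs := by linarith [hv.1]
        rw [abs_of_nonneg this]; exact ⟨by linarith [hv.1], rfl⟩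
      have hslope : ∀ v ∈ Icc b₀ β, σ₁ ≤ |deriv g v| := fun v hv => by
        rw [hσ₁]
        exact (mul_le_mul_of_nonneg_left (hdist v hv).1 hc₂.le).trans (abs_deriv_ge_of_fold hg hvs hcrit hfloor (hsub v hv))
      have hρi : IntervalIntegrable (fun v => F (v - vs)) volume b₀ β := by
        have hc := hFcont (b₀ - vs) (β - vs) (by rw [hb]; linarith) (by linarith)
        have h := (hc.intervalIntegrable).comp_sub_right vs
        simp only [sub_add_cancel] at h
        exact h
      have hρ : ∀ v ∈ Icc b₀ β, |(deriv X v * deriv g v - X v * iteratedDeriv 2 g v) / deriv g v ^ 2 * K (g v)| ≤ F (v - vs) := fun v hv => by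
        have h := hρpt v (hsub v hv) (hdist v hv).1
        rw [(hdist v hv).2] at h
        simpa only [hF] using h
      have hest := abs_intervalIntegral_mul_deriv_comp_le_ends_majorant hb₀β hg hX hK hσ₁pos hslope hρi hρ
      -- end terms
      have hends : (|X b₀| * |K (g b₀)| + |X β| * |K (g β)|) / σ₁ ≤ 2 * X₀ / (M * σ₁) := by
        have h1 := hend_of b₀ (hsub b₀ (left_mem_Icc.2 hb₀β)) (Or.inr (Or.inr (by rw [hb, add_sub_cancel_left, abs_of_pos hx₁pos])))
        rw [hXβ, abs_zero, zero_mul, add_zero, div_le_iff₀ hσ₁pos]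
        have e : 2 * X₀ / (M * σ₁) * σ₁ = X₀ * (2 / M) := by field_simp
        rw [e]; exact h1
      -- the majorant integral
      have hval : ∫ v in b₀..β, F (v - vs) ≤ X₁ / (c₂ * M) * log⁺ ((β - α) / x₁) + X₀ * L₂ / (c₂ ^ 2 * M * x₁) := by
        rw [intervalIntegral.integral_comp_sub_right F vs, hb, add_sub_cancel_left, hFval x₁ (β - vs) hx₁pos (by linarith)]
        exact hfar_val (β - vs) (by linarith) (by linarith [hvs.1])
      exact hest.trans (add_le_add hends hval)
    · have hb : b₀ = β := by rw [hb₀, min_eq_left h1]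
      rw [hb, intervalIntegral.integral_same, abs_zero]; exact hRHS0
  -- (3L) the left far piece
  have hI₁ : |∫ v in α..a₀, X v * deriv K (g v)| ≤
      2 * X₀ / (M * σ₁) + (X₁ / (c₂ * M) * log⁺ ((β - α) / x₁) + X₀ * L₂ / (c₂ ^ 2 * M * x₁)) := by
    have hRHS0 : 0 ≤ 2 * X₀ / (M * σ₁) + (X₁ / (c₂ * M) * log⁺ ((β - α) / x₁) + X₀ * L₂ / (c₂ ^ 2 * M * x₁)) := by
      have h1 : 0 ≤ 2 * X₀ / (M * σ₁) := by positivity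
      have h2 : 0 ≤ X₁ / (c₂ * M) * log⁺ ((β - α) / x₁) := mul_nonneg (by positivity) hposlogW
      have h3 : 0 ≤ X₀ * L₂ / (c₂ ^ 2 * M * x₁) := by positivity
      linarith
    rcases le_total α (vs - x₁) with h1 | h1
    · have ha : a₀ = vs - x₁ := by rw [ha₀, max_eq_right h1]
      have hsub : ∀ v ∈ Icc α a₀, v ∈ Icc α β := fun v hv => ⟨hv.1, by rw [ha] at hv; linarith [hv.2, hvs.2]⟩
      have hdist : ∀ v ∈ Icc α a₀, x₁ ≤ |v - vs| ∧ |v - vs| = vs - v := fun v hv => by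
        rw [ha] at hv
        have : v - vs ≤ 0 := by linarith [hv.2]
        rw [abs_of_nonpos this, neg_sub]; exact ⟨by linarith [hv.2], rfl⟩
      have hslope : ∀ v ∈ Icc α a₀, σ₁ ≤ |deriv g v| := fun v hv => by
        rw [hσ₁]
        exact (mul_le_mul_of_nonneg_left (hdist v hv).1 hc₂.le).trans (abs_deriv_ge_of_fold hg hvs hcrit hfloor (hsub v hv))
      have hρi : IntervalIntegrable (fun v => F (vs - v)) volume α a₀ := by
        have hc := hFcont (vs - a₀) (vs - α) (by rw [ha]; linarith) (by linarith)
        have h := ((hc.intervalIntegrable).comp_sub_left vs).symm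
        simp only [sub_sub_cancel] at h
        exact h
      have hρ : ∀ v ∈ Icc α a₀, |(deriv X v * deriv g v - X v * iteratedDeriv 2 g v) / deriv g v ^ 2 * K (g v)| ≤ F (vs - v) := fun v hv => by
        have h := hρpt v (hsub v hv) (hdist v hv).1
        rw [(hdist v hv).2] at h
        simpa only [hF] using h
      have hest := abs_intervalIntegral_mul_deriv_comp_le_ends_majorant hαa₀ hg hX hK hσ₁pos hslope hρi hρ
      have hends : (|X α| * |K (g α)| + |X a₀| * |K (g a₀)|) / σ₁ ≤ 2 * X₀ / (M * σ₁) := by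
        have h1 := hend_of a₀ (hsub a₀ (right_mem_Icc.2 hαa₀)) (Or.inr (Or.inr (by rw [ha, sub_sub_cancel_left, abs_neg, abs_of_pos hx₁pos])))
        rw [hXα, abs_zero, zero_mul, zero_add, div_le_iff₀ hσ₁pos]
        have e : 2 * X₀ / (M * σ₁) * σ₁ = X₀ * (2 / M) := by field_simp
        rw [e]; exact h1
      have hval : ∫ v in α..a₀, F (vs - v) ≤ X₁ / (c₂ * M) * log⁺ ((β - α) / x₁) + X₀ * L₂ / (c₂ ^ 2 * M * x₁) := by
        rw [intervalIntegral.integral_comp_sub_left F vs, ha, sub_sub_cancel, hFval x₁ (vs - α) hx₁pos (by linarith)]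
        exact hfar_val (vs - α) (by linarith) (by linarith [hvs.2])
      exact hest.trans (add_le_add hends hval)
    · have ha : a₀ = α := by rw [ha₀, max_eq_left h1]
      rw [ha, intervalIntegral.integral_same, abs_zero]; exact hRHS0
  -- (2') the two inner-outer pieces (possibly degenerate)
  have hposlog : 0 ≤ log⁺ (GM / t) := Real.posLog_nonneg
  have hRHSm : 0 ≤ 4 * X₀ / (M * σ) + (X₁ / σ + X₀ * L₂ / σ ^ 2) * (σ⁻¹ * (2 + 4 * log⁺ (GM / t))) := by
    have h1 : 0 ≤ 4 * X₀ / (M * σ) := by positivity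
    have h2 : 0 ≤ X₁ / σ + X₀ * L₂ / σ ^ 2 := by positivity
    have h3 : 0 ≤ σ⁻¹ * (2 + 4 * log⁺ (GM / t)) := mul_nonneg (inv_nonneg.2 hσpos.le) (by linarith [hposlog])
    exact add_nonneg h1 (mul_nonneg h2 h3)
  have hI₂' : |∫ v in a₀..a₁, X v * deriv K (g v)| ≤ 4 * X₀ / (M * σ) + (X₁ / σ + X₀ * L₂ / σ ^ 2) * (σ⁻¹ * (2 + 4 * log⁺ (GM / t))) := by
    rcases le_total α (vs - η) with h1 | h1
    · have ha1 : a₁ = vs - η := by rw [ha₁, max_eq_right h1]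
      -- outer end of this piece: `a₀` is either `α` (then `X = 0`) or `vs − x₁`
      have ha0 : X a₀ = 0 ∨ |a₀ - vs| = η ∨ |a₀ - vs| = x₁ := by
        rcases le_total α (vs - x₁) with h2 | h2
        · right; right; rw [ha₀, max_eq_right h2, sub_sub_cancel_left, abs_neg, abs_of_pos hx₁pos]
        · left; rw [ha₀, max_eq_left h2]; exact hXα
      refine hmid a₀ a₁ hαa₀ (ha₁vs.trans (hvsb₁.trans (hb₁b₀.trans hb₀β))) ha₀a₁ (fun v hv => ?_) ha0 (Or.inr (Or.inl ?_))
      · rw [ha1] at hv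
        have hv0 : v - vs ≤ 0 := by linarith [hv.2, hηpos]
        rw [abs_of_nonpos hv0, neg_sub]
        exact ⟨by linarith [hv.2], by linarith [hv.1, ha₀c]⟩
      · rw [ha1, abs_of_nonpos (by linarith)]; ring
    · have ha1 : a₁ = α := by rw [ha₁, max_eq_left h1]
      have ha0 : a₀ = α := le_antisymm (by rw [← ha1]; exact ha₀a₁) hαa₀
      rw [ha1, ha0, intervalIntegral.integral_same, abs_zero]; exact hRHSm
  have hI₄ : |∫ v in b₁..b₀, X v * deriv K (g v)| ≤ 4 * X₀ / (M * σ) + (X₁ / σ + X₀ * L₂ / σ ^ 2) * (σ⁻¹ * (2 + 4 * log⁺ (GM / t))) := by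
    rcases le_total (vs + η) β with h1 | h1
    · have hb1 : b₁ = vs + η := by rw [hb₁, min_eq_right h1]
      have hb0 : X b₀ = 0 ∨ |b₀ - vs| = η ∨ |b₀ - vs| = x₁ := by
        rcases le_total (vs + x₁) β with h2 | h2
        · right; right; rw [hb₀, min_eq_right h2, add_sub_cancel_left, abs_of_pos hx₁pos]
        · left; rw [hb₀, min_eq_left h2]; exact hXβ
      refine hmid b₁ b₀ ((hαa₀.trans ha₀a₁).trans (ha₁vs.trans hvsb₁)) hb₀β hb₁b₀ (fun v hv => ?_) (Or.inr (Or.inl ?_)) hb0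
      · rw [hb1] at hv
        have hv0 : 0 ≤ v - vs := by linarith [hv.1, hηpos]
        rw [abs_of_nonneg hv0]
        exact ⟨by linarith [hv.1], by linarith [hv.2, hb₀c]⟩
      · rw [hb1, abs_of_nonneg (by linarith)]; ring
    · have hb1 : b₁ = β := by rw [hb₁, min_eq_left h1]
      have hb0 : b₀ = β := le_antisymm hb₀β (by rw [← hb1]; exact hb₁b₀)
      rw [hb1, hb0, intervalIntegral.integral_same, abs_zero]; exact hRHSm
  -- (4) sum
  rw [hsplit]
  have htri : |(∫ v in α..a₀, X v * deriv K (g v)) + (∫ v in a₀..a₁, X v * deriv K (g v)) + (∫ v in a₁..b₁, X v * deriv K (g v)) +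
        (∫ v in b₁..b₀, X v * deriv K (g v)) + ∫ v in b₀..β, X v * deriv K (g v)| ≤
      |∫ v in α..a₀, X v * deriv K (g v)| + |∫ v in a₀..a₁, X v * deriv K (g v)| + |∫ v in a₁..b₁, X v * deriv K (g v)| +
        |∫ v in b₁..b₀, X v * deriv K (g v)| + |∫ v in b₀..β, X v * deriv K (g v)| := by
    refine (abs_add_le _ _).trans (add_le_add ((abs_add_le _ _).trans (add_le_add ((abs_add_le _ _).trans (add_le_add (abs_add_le _ _) le_rfl)) le_rfl)) le_rfl)
  refine htri.trans ?_
  have hsum := add_le_add (add_le_add (add_le_add (add_le_add hI₁ hI₂') hI₂) hI₄) hI₅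
  refine hsum.trans (le_of_eq ?_)
  ring


end Summit.HubbardSuperconductivity.HubbardSuperconductivity.Theorems.C4a

end
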